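import Literature.NumberTheory.GelbartRogawski1991.DoubledWeilRepresentationDetTwist
import Literature.NumberTheory.GelbartRogawski1991.CompatibleSplittingCMDoubling
import Literature.NumberTheory.GelbartRogawski1991.DoubledUnitarySiegelParabolicAlgebra
import Literature.NumberTheory.Automorphic.UnitaryGroupAdelicOneTorus
import Literature.NumberTheory.Automorphic.UnitaryGroupDualPairReindex
import Literature.NumberTheory.Automorphic.RelNormOneTorus
import HarnessLib

/-!
# The diagonal `U(𝕍)(𝔸) ↪ P_Δ(𝔸) ⊂ H(𝔸) = U(𝕍 ⊕ −𝕍)(𝔸)` and the Siegel normalisation read on it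

Topic `NumberTheory/GelbartRogawski1991`; namespace `Literature.NumberTheory.GelbartRogawski1991.GRConstruction`.
KERNEL only: three plumbing definitions with bodies (`toNegForm`: `U(σ, J) = U(σ, −J)` as an inclusion; `diagG` ∕ `diagGRat`: the diagonal
embedding, adelic and rational) and proved theorems; no `def … : Prop`, no named fact, no `sorry`.

[Kudla1994, §2] ∕ [HarrisKudlaSweet1996, §1 (1.11)–(1.15)]: in the doubling method for the unitary dual pair `(U(V), U(W))` the
doubled group `H = U(𝕍 ⊕ −𝕍)` contains `U(𝕍) × U(−𝕍) = U(𝕍) × U(𝕍)`, and its DIAGONAL `{(g, g)}` lies in the Siegel parabolic `P_Δ`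
stabilising `Δ = {(v, v)}`, with `det_Δ (g, g) = det g` — this is how the normalisation `ω(p) φ = χ(det_Δ p) |det_Δ p|^{1/2} φ(· p)`
of the doubled Weil representation is read back on `U(𝕍)`.  For the objects of `DoubledUnitaryGlobalSplittingData` (the tree's
doubled group `HA`, its blocks `blk`, `IsSiegelDelta`, `deltaBlock`, `detDelta`, `chiDet`, `modDelta`, the interface `IsDoubledWeilRep`)
this file provides:

* §1 `unitaryGroupOfForm_neg'` (`U(σ, −J) = U(σ, J)`), `toNegForm : U(σ, J) →* U(σ, −J)`;
* §2 **`diagG : G₁(𝔸) →* H(𝔸)`**, `g ↦ e₂-reindex (g_e ⊕ g_e)` (the pattern of `inlG`, second block read in `U(−J)`), `coe_diagG`,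
  `blk_diagG`, `continuous_diagG`, and the rational level `diagGRat`, `diagG_rationalPairToAdelic`, `diagG_rational` (`G₁(L⁺) ↦ H(L⁺)`);
* §3 **`isSiegelDelta_diagG`** (`(g, g) ∈ P_Δ(𝔸)`), `deltaBlock_diagG`, **`detDelta_diagG`** (`det_Δ (g,g) = det g`),
  `isUnit_detDelta_diagG`, **`chiDet_diagG`** (`χ(det_Δ (g,g)) = χ(det g)`), **`modDelta_diagG`** (`|det_Δ (g,g)|^{1/2} = 1`, since
  `det g ∈ U(1)(𝔸_{L⁺})` has idele norm one);
* §4 **`IsDoubledWeilRep.parabolic_diagG`** — the Siegel clause of a `χ`-normalised doubled Weil representation `sD` READ ON THE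
  DIAGONAL: `opD (r_Δ · sD (g,g) · r_Δ⁻¹) Φ 0 = χ(det g) · Φ 0` for every `Φ` — step (D1) of the (E1) route of the pub-hodgecm2 X3-Char
  ledger (`pinning/pin-3/E1-ROUTE.md`): together with the `K_H`-eigenvector property of the doubled archimedean vacuum and one
  non-vanishing it pins `e_P + e_Q = e_w(χ)` for the dictionary splitting `ι_χ` (NOT done here).

References: S. S. Kudla, *Splitting metaplectic covers of dual reductive pairs*, Israel J. Math. 87 (1994), §2–§3 [Kudla1994];
M. Harris, S. S. Kudla, W. J. Sweet, *Theta dichotomy for unitary groups*, J. AMS 9 (1996), §1 (1.11)–(1.15) [HarrisKudlaSweet1996];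
S. Gelbart, J. Rogawski, Invent. Math. 105 (1991), §3.1 Prop. 3.1.1 p. 455 [GelbartRogawski1991].
Provenance: pub-hodgecm2 cell (COR-CM), seat pin-3 (Δ2/X3 co-owner), X3-Char residual item (E), route step (D1).
HC_CM is NOT proved here or anywhere in the tree.
-/

set_option autoImplicit false

noncomputable section

open scoped Classical
open scoped Matrix Kronecker TensorProduct
open NumberField IsDedekindDomain
open Literature.RepresentationTheory.HeisenbergGroup
open Literature.NumberTheory.Automorphic
open Literature.NumberTheory.Weil1964
open Literature.RepresentationTheory.HarrisKudlaSweet1996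
open Literature.NumberTheory.GaloisRepresentations

namespace Literature.NumberTheory.GelbartRogawski1991.GRConstruction

open UnitaryDualPair

/-! ## §1 `U(σ, −J) = U(σ, J)` -/

section Neg

variable {S : Type*} [CommRing S] {m : Type*} [Fintype m] [DecidableEq m]

/-- **`U(σ, −J) = U(σ, J)`**: `ḡᵀ (−J) g = −J ↔ ḡᵀ J g = J`. [cite: Kudla1994, §2 (doubled space, Siegel parabolic)] -/
theorem unitaryGroupOfForm_neg' (σ : S →+* S) (J : Matrix m m S) : unitaryGroupOfForm σ (-J) = unitaryGroupOfForm σ J := by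
  ext g
  rw [mem_unitaryGroupOfForm_iff, mem_unitaryGroupOfForm_iff, Matrix.mul_neg, Matrix.neg_mul, neg_inj]

/-- **the identity map `U(σ, J) →* U(σ, −J)`** (`−𝕍` has the same isometry group as `𝕍`).
[cite: Kudla1994, §2 (doubled space, Siegel parabolic)] -/
def toNegForm (σ : S →+* S) (J : Matrix m m S) : unitaryGroupOfForm σ J →* unitaryGroupOfForm σ (-J) :=
  Subgroup.inclusion (le_of_eq (unitaryGroupOfForm_neg' σ J).symm)

/-- matrix of `toNegForm g`: that of `g`. [cite: Kudla1994, §2 (doubled space, Siegel parabolic)] -/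
@[simp] theorem coe_toNegForm (σ : S →+* S) (J : Matrix m m S) (g : unitaryGroupOfForm σ J) :
    ((toNegForm σ J g : unitaryGroupOfForm σ (-J)) : GL m S) = (g : GL m S) := rfl

end Neg

variable (L : Type) [Field L] [NumberField L] [IsCMField L]

variable {N M n : ℕ} (e : Fin N × Fin M ≃ Fin n)
  (dV : Fin N → L) (hdV : ∀ i, IsCMField.complexConj L (dV i) = dV i) (hdV0 : ∀ i, dV i ≠ 0)
  (dW : Fin M → L) (hdW : ∀ i, IsCMField.complexConj L (dW i) = dW i) (hdW0 : ∀ i, dW i ≠ 0)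

local notation "𝔸L" => AdeleRing (𝓞 L) L

/-! ## §2 The diagonal embedding -/

section Diag

/-- **`U(𝕍)(𝔸) ↪ H(𝔸)`, `g ↦ (g, g)`**: on `G₁(𝔸) = adelicPair … (diag dV) (diag dW)` (index `Fin N × Fin M`, re-enumerated by `e`) the
block-diagonal `g ⊕ g` on `Fin n ⊕ Fin n`, the second block read in `U(−J)` (`toNegForm`), re-enumerated by `e₂` and cast along
`adelicForm_hermD_eq` — the pattern of `inlG` (`g ↦ g ⊕ 1`). [cite: Kudla1994, §2 (doubled space, Siegel parabolic)] [cite: HarrisKudlaSweet1996, §1 (1.11)–(1.12)] -/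
def diagG : UnitaryGroup.adelicPair (Fp L) L (IsCMField.complexConj L) N M (Matrix.diagonal dV) (Matrix.diagonal dW) →*
    HA L e dV hdV dW hdW :=
  (Subgroup.inclusion (le_of_eq (congrArg (unitaryGroupOfForm (UnitaryGroup.conjAdele (Fp L) L (IsCMField.complexConj L)))
      (adelicForm_hermD_eq L e dV hdV dW hdW).symm))).comp <|
    (UnitaryGroup.reindexU _ (e₂ (n := n)) _).comp <|
      (UnitaryGroup.blockDiag _ _ _).comp <|
        (MonoidHom.prod (UnitaryGroup.reindexU _ e _) ((toNegForm _ _).comp (UnitaryGroup.reindexU _ e _)))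

/-- the GL-matrix of `(g, g) ∈ H(𝔸)`: `reindex e₂ (diag (reindex e g, reindex e g))`.
[cite: Kudla1994, §2 (doubled space, Siegel parabolic)] -/
theorem coe_diagG (g : UnitaryGroup.adelicPair (Fp L) L (IsCMField.complexConj L) N M (Matrix.diagonal dV) (Matrix.diagonal dW)) :
    ((diagG L e dV hdV dW hdW g : HA L e dV hdV dW hdW) : GL (Fin (n + n)) 𝔸L) =
      UnitaryGroup.reindexGL (e₂ (n := n))
        (UnitaryGroup.blockDiagGL (UnitaryGroup.reindexGL e (g : GL (Fin N × Fin M) 𝔸L),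
          UnitaryGroup.reindexGL e (g : GL (Fin N × Fin M) 𝔸L))) :=
  rfl

/-- the block matrix of `(g, g)` on `Fin n ⊕ Fin n`: `diag (g_e, g_e)`. [cite: Kudla1994, §2 (doubled space, Siegel parabolic)] -/
theorem blk_diagG (g : UnitaryGroup.adelicPair (Fp L) L (IsCMField.complexConj L) N M (Matrix.diagonal dV) (Matrix.diagonal dW)) :
    blk L e dV hdV dW hdW (diagG L e dV hdV dW hdW g) =
      Matrix.fromBlocks (Matrix.reindex e e ((g : GL (Fin N × Fin M) 𝔸L) : Matrix (Fin N × Fin M) (Fin N × Fin M) 𝔸L)) 0 0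
        (Matrix.reindex e e ((g : GL (Fin N × Fin M) 𝔸L) : Matrix (Fin N × Fin M) (Fin N × Fin M) 𝔸L)) := by
  rw [blk, coe_diagG, UnitaryGroup.coe_reindexGL, UnitaryGroup.coe_blockDiagGL, UnitaryGroup.coe_reindexGL, Matrix.reindex_apply,
    Matrix.reindex_apply, Matrix.submatrix_submatrix, Equiv.symm_symm, Equiv.symm_comp_self, Matrix.submatrix_id_id]

/-- `g ↦ (g, g)` is continuous. [cite: Kudla1994, §2 (doubled space, Siegel parabolic)] -/
theorem continuous_diagG : Continuous (diagG L e dV hdV dW hdW) := by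
  refine continuous_induced_rng.2 ?_
  change Continuous fun g => ((diagG L e dV hdV dW hdW g : HA L e dV hdV dW hdW) : GL (Fin (n + n)) 𝔸L)
  simp only [coe_diagG]
  exact (UnitaryGroup.continuous_reindexGL _).comp (UnitaryGroup.continuous_blockDiagGL.comp
    (((UnitaryGroup.continuous_reindexGL _).comp continuous_subtype_val).prodMk
      ((UnitaryGroup.continuous_reindexGL _).comp continuous_subtype_val)))

/-- the RATIONAL-level `g ↦ (g, g)`: `G₁(L⁺) →* H(L⁺)` (pattern of `inlGRat`, cast along `hermD_eq`).
[cite: Kudla1994, §2 (doubled space, Siegel parabolic)] -/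
def diagGRat : UnitaryGroup.rationalPair (Fp L) L (IsCMField.complexConj L) N M (Matrix.diagonal dV) (Matrix.diagonal dW) →*
    UnitaryGroup.rational (Fp L) L (IsCMField.complexConj L) (n + n) (hermD L e dV hdV dW hdW) :=
  (Subgroup.inclusion (le_of_eq (congrArg (unitaryGroupOfForm ((IsCMField.complexConj L : L ≃ₐ[Fp L] L) : L →+* L))
      (hermD_eq L e dV hdV dW hdW).symm))).comp <|
    (UnitaryGroup.reindexU _ (e₂ (n := n)) _).comp <|
      (UnitaryGroup.blockDiag _ _ _).comp <|
        (MonoidHom.prod (UnitaryGroup.reindexU _ e _) ((toNegForm _ _).comp (UnitaryGroup.reindexU _ e _)))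

/-- **`g ↦ (g, g)` carries `G₁(L⁺)` into `H(L⁺)`**: `diagG (γ ⊗ 1) = (diagGRat γ) ⊗ 1`.
[cite: Kudla1994, §2 (doubled space, Siegel parabolic)] -/
theorem diagG_rationalPairToAdelic (γ : UnitaryGroup.rationalPair (Fp L) L (IsCMField.complexConj L) N M
      (Matrix.diagonal dV) (Matrix.diagonal dW)) :
    diagG L e dV hdV dW hdW (UnitaryGroup.rationalPairToAdelic (Fp L) L (IsCMField.complexConj L) N M
        (Matrix.diagonal dV) (Matrix.diagonal dW) γ) =
      UnitaryGroup.toAdelic (Fp L) L (IsCMField.complexConj L) (n + n) (hermD L e dV hdV dW hdW)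
        (diagGRat L e dV hdV dW hdW γ) := by
  apply Subtype.ext
  apply Units.ext
  set A := ((γ : GL (Fin N × Fin M) L) : Matrix (Fin N × Fin M) (Fin N × Fin M) L) with hA
  set φ := algebraMap L (AdeleRing (𝓞 L) L) with hφ
  change Matrix.reindex (e₂ (n := n)) (e₂ (n := n))
      (Matrix.fromBlocks (Matrix.reindex e e (A.map φ)) 0 0 (Matrix.reindex e e (A.map φ))) =
    (Matrix.reindex (e₂ (n := n)) (e₂ (n := n)) (Matrix.fromBlocks (Matrix.reindex e e A) 0 0 (Matrix.reindex e e A))).map φ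
  simp only [Matrix.reindex_apply, ← Matrix.submatrix_map, Matrix.fromBlocks_map, Matrix.map_zero _ (map_zero φ)]

/-- `g ↦ (g, g)` carries `G₁(L⁺)` into `H(L⁺)`. [cite: Kudla1994, §2 (doubled space, Siegel parabolic)] -/
theorem diagG_rational :
    ∀ γ ∈ (UnitaryGroup.rationalPairToAdelic (Fp L) L (IsCMField.complexConj L) N M
        (Matrix.diagonal dV) (Matrix.diagonal dW)).range, diagG L e dV hdV dW hdW γ ∈ ratH L e dV hdV dW hdW := by
  rintro _ ⟨γ, rfl⟩
  exact ⟨diagGRat L e dV hdV dW hdW γ, (diagG_rationalPairToAdelic L e dV hdV dW hdW γ).symm⟩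

end Diag

/-! ## §3 `(g, g) ∈ P_Δ(𝔸)`, `det_Δ (g, g) = det g`, the prescribed scalars -/

section Siegel

/-- **`(g, g)` stabilises the diagonal `Δ`**: `(g, g) ∈ P_Δ(𝔸)` (both block-row sums are `g_e`).
[cite: Kudla1994, §2 (doubled space, Siegel parabolic)] [cite: HarrisKudlaSweet1996, §1 (1.11)–(1.12)] -/
theorem isSiegelDelta_diagG (g : UnitaryGroup.adelicPair (Fp L) L (IsCMField.complexConj L) N M (Matrix.diagonal dV) (Matrix.diagonal dW)) :
    IsSiegelDelta L e dV hdV dW hdW (diagG L e dV hdV dW hdW g) := by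
  rw [IsSiegelDelta, blk_diagG, Matrix.toBlocks_fromBlocks₁₁, Matrix.toBlocks_fromBlocks₁₂, Matrix.toBlocks_fromBlocks₂₁,
    Matrix.toBlocks_fromBlocks₂₂, add_zero, zero_add]

/-- the action of `(g, g)` on `Δ ≅ 𝕍`: `g_e`. [cite: Kudla1994, §2 (doubled space, Siegel parabolic)] -/
theorem deltaBlock_diagG (g : UnitaryGroup.adelicPair (Fp L) L (IsCMField.complexConj L) N M (Matrix.diagonal dV) (Matrix.diagonal dW)) :
    deltaBlock L e dV hdV dW hdW (diagG L e dV hdV dW hdW g) =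
      Matrix.reindex e e ((g : GL (Fin N × Fin M) 𝔸L) : Matrix (Fin N × Fin M) (Fin N × Fin M) 𝔸L) := by
  rw [deltaBlock, blk_diagG, Matrix.toBlocks_fromBlocks₁₁, Matrix.toBlocks_fromBlocks₁₂, add_zero]

/-- **`det_Δ (g, g) = det g`**. [cite: Kudla1994, §3] [cite: HarrisKudlaSweet1996, §1 (1.11)–(1.12)] -/
theorem detDelta_diagG (g : UnitaryGroup.adelicPair (Fp L) L (IsCMField.complexConj L) N M (Matrix.diagonal dV) (Matrix.diagonal dW)) :
    detDelta L e dV hdV dW hdW (diagG L e dV hdV dW hdW g) =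
      ((g : GL (Fin N × Fin M) 𝔸L) : Matrix (Fin N × Fin M) (Fin N × Fin M) 𝔸L).det := by
  rw [detDelta, deltaBlock_diagG, Matrix.det_reindex_self]

/-- `det_Δ (g, g)` is a unit (it is `det` of an invertible matrix). [cite: Kudla1994, §3] -/
theorem isUnit_detDelta_diagG
    (g : UnitaryGroup.adelicPair (Fp L) L (IsCMField.complexConj L) N M (Matrix.diagonal dV) (Matrix.diagonal dW)) :
    IsUnit (detDelta L e dV hdV dW hdW (diagG L e dV hdV dW hdW g)) := by
  rw [detDelta_diagG]
  exact (Matrix.isUnits_det_units _)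

/-- the unit `det_Δ (g, g)` IS the idele `det g`. [cite: Kudla1994, §3] -/
theorem unit_detDelta_diagG
    (g : UnitaryGroup.adelicPair (Fp L) L (IsCMField.complexConj L) N M (Matrix.diagonal dV) (Matrix.diagonal dW)) :
    (isUnit_detDelta_diagG L e dV hdV dW hdW g).unit = Matrix.GeneralLinearGroup.det (g : GL (Fin N × Fin M) 𝔸L) :=
  Units.ext (by rw [IsUnit.unit_spec, detDelta_diagG, Matrix.GeneralLinearGroup.val_det_apply])

/-- **`χ(det_Δ (g, g)) = χ(det g)`** for a Hecke character `χ` of `L`. [cite: HarrisKudlaSweet1996, §1 (1.11)–(1.12)] -/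
theorem chiDet_diagG (χ : HeckeCharacter L)
    (g : UnitaryGroup.adelicPair (Fp L) L (IsCMField.complexConj L) N M (Matrix.diagonal dV) (Matrix.diagonal dW)) :
    chiDet L e dV hdV dW hdW χ (diagG L e dV hdV dW hdW g) = χ (Matrix.GeneralLinearGroup.det (g : GL (Fin N × Fin M) 𝔸L)) := by
  have hu := isUnit_detDelta_diagG L e dV hdV dW hdW g
  unfold chiDet
  rw [dif_pos hu, unit_detDelta_diagG]

omit [IsCMField L] in
/-- `det (reindex e g) = det g` in `GL`. [cite: Kudla1994, §3] -/
private theorem det_reindexGL (g' : GL (Fin N × Fin M) 𝔸L) :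
    Matrix.GeneralLinearGroup.det (UnitaryGroup.reindexGL e g') = Matrix.GeneralLinearGroup.det g' :=
  Units.ext (by rw [Matrix.GeneralLinearGroup.val_det_apply, Matrix.GeneralLinearGroup.val_det_apply, UnitaryGroup.coe_reindexGL,
    Matrix.det_reindex_self])

omit [NumberField L] [IsCMField L] in
include hdV0 hdW0 in
/-- `det (reindex e e (diag dV ⊗ diag dW)) ≠ 0`. [cite: Kudla1994, §3] -/
private theorem det_reindex_kronecker_ne_zero :
    (Matrix.reindex e e (Matrix.diagonal dV ⊗ₖ Matrix.diagonal dW)).det ≠ 0 := by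
  rw [Matrix.det_reindex_self, Matrix.det_kronecker, Matrix.det_diagonal, Matrix.det_diagonal]
  exact mul_ne_zero (pow_ne_zero _ (Finset.prod_ne_zero_iff.2 fun i _ => hdV0 i))
    (pow_ne_zero _ (Finset.prod_ne_zero_iff.2 fun i _ => hdW0 i))

include e hdV0 hdW0 in
/-- **`det g ∈ U(1)(𝔸_{L⁺})`** for `g ∈ G₁(𝔸) = U(diag dV ⊗ diag dW)(𝔸_{L⁺})` (`(c ⊗ 1)(det g) · det g = 1`; read through the
re-enumeration `e`, any one). [cite: HarrisKudlaSweet1996, §1 (1.11)–(1.12)] -/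
theorem det_mem_adelicOne
    (g : UnitaryGroup.adelicPair (Fp L) L (IsCMField.complexConj L) N M (Matrix.diagonal dV) (Matrix.diagonal dW)) :
    Matrix.GeneralLinearGroup.det (g : GL (Fin N × Fin M) 𝔸L) ∈
      UnitaryGroup.adelicOne (Fp L) L (IsCMField.complexConj L) := by
  have h := UnitaryGroup.det_mem_adelicOne (Fp L) L (IsCMField.complexConj L) n
    (Matrix.reindex e e (Matrix.diagonal dV ⊗ₖ Matrix.diagonal dW)) (det_reindex_kronecker_ne_zero L e dV hdV0 dW hdW0)
    (UnitaryGroup.adelicPairEmb (Fp L) L (IsCMField.complexConj L) N M e (Matrix.diagonal dV) (Matrix.diagonal dW) g)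
  rwa [UnitaryGroup.coe_adelicPairEmb, det_reindexGL] at h

include hdV0 hdW0 in
/-- **`|det_Δ (g, g)|_{𝔸_L}^{1/2} = 1`**: `det g ∈ U(1)(𝔸_{L⁺}) ⊆ 𝕀_L¹` (relative norm one ⇒ idele norm one).
[cite: HarrisKudlaSweet1996, §1 (1.11)–(1.12)] -/
theorem modDelta_diagG
    (g : UnitaryGroup.adelicPair (Fp L) L (IsCMField.complexConj L) N M (Matrix.diagonal dV) (Matrix.diagonal dW)) :
    modDelta L e dV hdV dW hdW (diagG L e dV hdV dW hdW g) = 1 := by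
  have hu := isUnit_detDelta_diagG L e dV hdV dW hdW g
  have h1 : IdeleClassGroup.ideleNorm L (Matrix.GeneralLinearGroup.det (g : GL (Fin N × Fin M) 𝔸L)) = 1 := by
    rw [← mem_normOneIdeles]
    apply relNormOneIdeles_le_normOneIdeles (maximalRealSubfield L) L
    rw [← UnitaryGroup.cm_adelicOne_eq_relNormOneIdeles]
    exact det_mem_adelicOne L e dV hdV0 dW hdW0 g
  unfold modDelta
  rw [dif_pos hu, unit_detDelta_diagG, ← coe_ideleNorm, h1, NNReal.coe_one, Real.sqrt_one]

end Siegel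

/-! ## §4 The Siegel normalisation read on the diagonal -/

section Parabolic

include hdV0 hdW0 in
/-- **The parabolic clause of a `χ`-normalised doubled Weil representation ON THE DIAGONAL `U(𝕍)`**: for `sD` with
`IsDoubledWeilRep … χ sD` and every `g ∈ G₁(𝔸)`, `Φ ∈ 𝒮(𝔸^{n+n})`:
`opD (r_Δ · sD (g,g) · r_Δ⁻¹) Φ 0 = χ(det g) · Φ 0` — the prescribed scalar `χ(det_Δ p) |det_Δ p|^{1/2}` at `p = (g, g)` is `χ(det g)`.
[cite: HarrisKudlaSweet1996, §1 (1.11)–(1.15)] [cite: Kudla1994, §3 Thm. 3.1] -/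
theorem IsDoubledWeilRep.parabolic_diagG {χ : HeckeCharacter L} {sD : HA L e dV hdV dW hdW →* MpD L e dV hdV dW hdW}
    (hs : IsDoubledWeilRep L e dV hdV hdV0 dW hdW hdW0 χ sD)
    (g : UnitaryGroup.adelicPair (Fp L) L (IsCMField.complexConj L) N M (Matrix.diagonal dV) (Matrix.diagonal dW))
    (Φ : piSchwartzBruhat (Fp L) (Fin (n + n))) :
    opD L e dV hdV dW hdW (rDelta L e dV hdV hdV0 dW hdW hdW0 * sD (diagG L e dV hdV dW hdW g) *
        (rDelta L e dV hdV hdV0 dW hdW hdW0)⁻¹) Φ 0 =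
      ((χ (Matrix.GeneralLinearGroup.det (g : GL (Fin N × Fin M) 𝔸L)) : ℂˣ) : ℂ) *
        (Φ : (Fin (n + n) → AdeleRing (𝓞 (Fp L)) (Fp L)) → ℂ) 0 := by
  rw [hs.parabolic _ (isSiegelDelta_diagG L e dV hdV dW hdW g) (isUnit_detDelta_diagG L e dV hdV dW hdW g) Φ,
    chiDet_diagG, modDelta_diagG L e dV hdV hdV0 dW hdW hdW0, Complex.ofReal_one, mul_one]

end Parabolic

end Literature.NumberTheory.GelbartRogawski1991.GRConstruction

end
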